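import Literature.AlgebraicGeometry.Motives.AbelianVarietyAmpleProofs
import Literature.AlgebraicGeometry.Motives.CartierDivisorOfComplementProofs
import HarnessLib

/-!
# Abelian varieties are projective, from the Theorem of the Cube alone

The named fact `Literature.AlgebraicGeometry.Motives.AbelianVariety.isProjectiveOver` (every
abelian variety over every field `k` admits a closed `k`-immersion into some `ℙⁿ_k`; Milne,
*Abelian Varieties* (1986), Thm. 7.1: "Every abelian variety is projective"; Mumford, *Abelian
Varieties*, §6, Application 1, p. 62 for `k = k̄`; Görtz–Wedhorn II, Prop. 27.174) was reduced in
`Motives/AbelianVarietyAmpleProofs` (`AbelianVariety.isProjectiveOver_of_theoremOfCube`) to two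
printed theorems over `k̄`: the Theorem of the Cube (Görtz–Wedhorn II, Thm. 24.73; the named fact
`theoremOfCube_linEquiv` of `Motives/AbelianVarietyTheoremOfCube`) and Görtz–Wedhorn II,
Lemma 25.150 for the abelian varieties over `k̄` (`CartierDivisor.exists_isEffective_avoids_iff`).
The latter is now a theorem (`CartierDivisor.exists_isEffective_avoids_iff_holds`,
`Motives/CartierDivisorOfComplementProofs`: Lemma 25.150 from Auslander–Buchsbaum,
`Motives/CartierDivisorOfComplement`, and Auslander–Buchsbaum itself,
`Resolution/RegularLocalRingsUFD`). Hence: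

* `AbelianVariety.isProjectiveOver_of_cube` — **projectivity of all abelian varieties over all
  fields from the Theorem of the Cube alone.** Everything else in Milne's proof of Thm. 7.1 /
  Görtz–Wedhorn's proof of Prop. 27.174 is proved in this tree: the theorem of the square from the
  cube (`Motives/AbelianVarietyTheoremOfCube`, `Motives/AbelianVarietyTranslation`), Lemma 27.175
  and the ampleness of `X ∖ U` (`Motives/AbelianVarietyAmpleProofs`), proper + ample ⇒ projective
  (`Motives/ProjectiveOfAmpleDivisor`, `Motives/ProjectiveOfGeneratingSections`), Lemma 25.150
  (`Motives/CartierDivisorOfComplement(Proofs)`, with Auslander–Buchsbaum,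
  `Resolution/RegularLocalRingsUFD`, and smooth ⇒ regular, `Motives/VarietiesRegularProofs`), and
  the descent `k̄ ⇒ k` (`Motives/ProjectiveDescentProofs`, Görtz–Wedhorn I, Prop. 14.57; Milne,
  Thm. 7.1, final step).
* `AbelianVariety.isSmoothProjective_of_cube` — the same for the named fact `A.isSmoothProjective`.

What remains named: the Theorem of the Cube (coherent cohomology and base change, Görtz–Wedhorn II
Thm. 24.66 / Lemma 24.72 / Künneth, absent from Mathlib).

## References

* J. S. Milne, *Abelian Varieties*, Ch. V of Cornell–Silverman, *Arithmetic Geometry*, Springer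
  (1986): §7, Thm. 7.1 (p. 112), proof pp. 112–114. [Milne1986AbelianVarieties]
* D. Mumford, *Abelian Varieties* (1970): §6, Application 1, p. 62. [MumfordAV1970]
* U. Görtz, T. Wedhorn, *Algebraic Geometry II* (2023): Thm. 24.73 (p. 550), Lemma 25.150 (p. 670),
  Prop. 27.174 (p. 880). [GortzWedhorn2023]
* U. Görtz, T. Wedhorn, *Algebraic Geometry I*, 2nd ed. (2020): Prop. 14.57 (p. 571). [GortzWedhorn2020]
-/

universe u

open CategoryTheory AlgebraicGeometry

noncomputable section

namespace Literature.AlgebraicGeometry.Motives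

namespace AbelianVariety

/-- **Every abelian variety over every field is projective, granted the Theorem of the Cube**
(Milne, *Abelian Varieties* (1986), Thm. 7.1: "Every abelian variety is projective"; Görtz–Wedhorn
II, Prop. 27.174): the named fact `AbelianVariety.isProjectiveOver` at the field `k` from
`theoremOfCube_linEquiv` (Görtz–Wedhorn II, Thm. 24.73) alone, by
`isProjectiveOver_of_theoremOfCube` (`Motives/AbelianVarietyAmpleProofs`) and the theorem
`CartierDivisor.exists_isEffective_avoids_iff_holds` (Lemma 25.150 for the abelian varieties over
`k̄`, `Motives/CartierDivisorOfComplementProofs`).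
[cite: Milne1986AbelianVarieties, Thm. 7.1 (p. 112)] [cite: GortzWedhorn2023, Prop. 27.174 (p. 880) with Thm. 24.73 (p. 550)] -/
theorem isProjectiveOver_of_cube {k : Type u} [Field k] (hcube : theoremOfCube_linEquiv.{u}) :
    AbelianVariety.isProjectiveOver (k := k) :=
  isProjectiveOver_of_theoremOfCube hcube (fun _ => CartierDivisor.exists_isEffective_avoids_iff_holds)

/-- The named fact `A.isSmoothProjective` (`Motives/AbelianVariety`: smooth of relative dimension
`dim A`, projective, geometrically irreducible) for every abelian variety `A` over every field,
granted the Theorem of the Cube alone; smoothness and the dimension count are unconditional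
(`isSmoothProjective_of_isProjectiveOver`, `Motives/AbelianVarietyProofs`).
[cite: GortzWedhorn2023, Prop. 27.174 (p. 880) with Thm. 24.73 (p. 550)] -/
theorem isSmoothProjective_of_cube {k : Type u} [Field k] (A : AbelianVariety k)
    (hcube : theoremOfCube_linEquiv.{u}) : A.isSmoothProjective :=
  A.isSmoothProjective_of_isProjectiveOver (isProjectiveOver_of_cube hcube A)

end AbelianVariety

end Literature.AlgebraicGeometry.Motives

end
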